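import Literature.RepresentationTheory.KonnoKonno2007.JunctionVacuumDefinite
import Literature.Analysis.SegalBargmann.SchwartzCompactWeilDatum
import HarnessLib

/-!
# The junction `U(3,0) × U(1)` of the real unitary dual pair at a DEFINITE place: the instance of record, the
# vacuum character and the `U(W) = U(1)`-weights of the degree lines, HYPOTHESIS-FREE (Konno–Konno 2007 Lemma 5.2 ·
# Folland 1989 Prop. (4.39))

Topic `RepresentationTheory/KonnoKonno2007`; namespace `Literature.RepresentationTheory.KonnoKonno2007.RealDualPair`.
KERNEL ONLY: every statement below is PROVED from landed tree theorems; no named fact, no `Prop`-valued definition,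
no definition at all, no hypothesis.  Companion of `JunctionInstanceU21U1` (the junction `U(2,1) × U(1)` at the CM place
`ι₁`); here the hermitian space `V` is DEFINITE at the place (`sgn V_b = (3,0)`, block types `(P,Q) = (Fin 3, ∅)`) and the
line `W` has either sign (`(R,S) = (Unit, ∅)` «`U(3,0) × U(1,0)`» or `(R,S) = (∅, Unit)` «`U(3,0) × U(0,1)`»).

WHY THIS FILE.  The FLOOR-0 programme P4 of the Hodge-CM cell (line `Cruxes/H413/Lines/F0_P4AdmissibleOccursInH1`, stub
`stub_T3a_holThetaRealisationOfRallisAt`, seat (ii) «local occupancy»; census `TYPED-CENSUS-S4ii` §2 «arch definite occupancy: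
∅ junction instance `(3,0,1,0)`») needs, at every archimedean place `b ≠ ι₁` of the CM field (`U(V_b) ≅ U(3)`, `U(W_b) ≅ U(1)`,
both COMPACT), the NAME of the `U(W_b)`-character carried by the Gaussian and by the degree lines of the Fock model under an
archimedean Weil datum over the pair — the archimedean definite-place half of the Fock-occupancy dictionary of [Liu2021,
Def. 4.12, Lem. D.2 (1)].  This file supplies it in the tree's block currency, with nothing left as a binder:

* §0 (generic complements, any `P Q R S`; imports only the BUILT light layer `JunctionVacuumDefinite` +
  `SchwartzCompactWeilDatum`, not the metaplectic `JunctionWeilDatumGeneralRank`): `kV` and `κ` are injective, hence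
  **`κ : K_V × K_W → G_∞` is a BIJECTION when both `V` and `W` are definite** (`κ_bijective`), a homeomorphism (compact
  source, Hausdorff target), and the compact pair's CONSTRUCTED datum `dualPairWeilRep χ` (`SchwartzCompactWeilDatum`)
  transports along it to an archimedean Weil datum over the junction's `ι𝕎` for EVERY continuous character `χ` of
  `K_V × K_W` (`exists_isArchWeilDatum_of_definite` — elementary: no metaplectic cocycle is needed when both members are
  compact); with the `V`-block `P` or `Q` empty the record `FockVacuumCharacter` does not see `e_P` ∕ `e_Q` (`eP_irrel` ∕
  `eQ_irrel`, twins of the tree's `eR_irrel` ∕ `eS_irrel`); hence **when BOTH `V` and `W` are definite EVERY exponent tuple is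
  realised** over the concrete junction (`fockVacuumCharacter_junction_of_definite`, `χ := vacCharCircle e`), ONE datum has the
  Gaussian INVARIANT under the whole group (`exists_forall_vacuum_eq_self_of_definite`, `χ := 1`), and for EVERY datum the
  centre `t·1` of `U(W)` acts on the Hermite vector `h_m` by `vacScalar e (1,(t,t)) · t^{deg_{PR}+deg_{QS}} · t̄^{deg_{PS}+deg_{QR}}`
  (`exists_forall_scalarW_hermitePi`) — so at a definite place NO vacuum exponent is decided by the datum notion: the
  `U(W_b)`-weight of the Gaussian is a normalisation of the DATUM (an integer `e_R` resp. `e_S`), exactly as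
  `JunctionVacuumDefinite` says for the `U(V_b)`-weight.
* §1 `U(3,0) × U(1,0)` (`(Fin 3, ∅, Unit, ∅)`): the junction inhabited, `κ` onto (`junction_def₃₁_spec`); a datum with the Gaussian INVARIANT under the whole group `U(3) × U(1)`
  (`exists_forall_vacuum_eq_self_def₃₁`); every tuple realised (`fockVacuumCharacter_def₃₁`); and for EVERY archimedean Weil
  datum over the junction **the centre `t ∈ U(1) = U(W)` acts on the Hermite vector `h_m` by `t^{e_R + deg m}`**
  (`exists_forall_scalarW_hermitePi_def₃₁`; `deg m = degPR m`, all variables are of type `V⁺ ⊗ W⁺`): the `U(W)`-characters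
  occurring are EXACTLY `t ↦ t^n`, `n ≥ e_R`, the Gaussian carrying `n = e_R` and the degree-`d` lines `n = e_R + d`.
* §2 `U(3,0) × U(0,1)` (`(Fin 3, ∅, ∅, Unit)`): the same for the line of the OTHER sign — every tuple realised, an
  invariant-Gaussian datum, and the centre of `U(W)` acts on `h_m` by `t^{e_S − deg m}` (`deg m = degPS m`, all variables of
  the MIXED type `V⁺ ⊗ W⁻`): the occurring `U(W)`-characters are `t^n`, `n ≤ e_S`.
So the two signs of the line are told apart by the DIRECTION of the `U(W)`-ladder above∕below the vacuum weight — the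
block-currency form of «`(−1,−,0)` vs `(1,+,0)`» in [Liu2021, Lem. D.2]; which integer `e_R` ∕ `e_S` the PIN's datum has
at `b` is a normalisation of that datum (its archimedean splitting character), not decided here.

Sources (held; journal page = PDF page + 34 for KK07): T. Konno, K. Konno, *On doubling construction for real unitary dual
pairs*, Kyushu J. Math. 61 (2007) 35–82, §3.1 (3.1) p. 44, Lemma 5.2 p. 73 [corpus: paper:doi-10-2206-kyushujm-61-35 p0039
L44–45]; G. B. Folland, *Harmonic Analysis in Phase Space* (1989), §1.7, §4.2 Prop. (4.39), Ch. 4 §5; Y. Liu, Camb. J. Math. 9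
(2021), Def. 4.12, App. D Lem. D.2 (1) (conventions ∕ provenance only: nothing of [Liu2021] is asserted here).
-/

set_option autoImplicit false

noncomputable section

open MeasureTheory Complex SchwartzMap Matrix
open scoped InnerProductSpace ComplexConjugate Real

namespace Literature.RepresentationTheory.KonnoKonno2007

namespace RealDualPair

open Literature.Analysis.SegalBargmann Literature.RepresentationTheory.HeisenbergGroup
open Literature.NumberTheory.Weil1964 Literature.NumberTheory.Automorphic
open Literature.NumberTheory.Automorphic.UnitaryGroup Literature.RepresentationTheory.CompactGroups

/-! ## §0. Generic complements: with a `V`-block empty its exponent is invisible; both definite ⇒ every tuple -/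

section Generic

variable {P Q R S : Type*} [Fintype P] [DecidableEq P] [Fintype Q] [DecidableEq Q] [Fintype R] [DecidableEq R]
  [Fintype S] [DecidableEq S]

/-- with `Q` empty the exponent `e_Q` is invisible in the vacuum scalar (`det` of an empty matrix is `1`): the `U(V⁻)`-factor
of the determinant character of [KonnoKonno2007, Lemma 5.2] is absent. [cite: KonnoKonno2007, Lemma 5.2 (i)/(ii) p. 73 L44–102] -/
theorem vacScalar_eQ_of_isEmpty [IsEmpty Q] (e : VacExponents) (b : ℤ) (k : DPK P Q R S) :
    vacScalar (⟨e.eP, b, e.eR, e.eS⟩ : VacExponents) k = vacScalar e k := by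
  simp only [vacScalar, Matrix.det_isEmpty, _root_.one_zpow]

/-- with `P` empty the exponent `e_P` is invisible in the vacuum scalar (no `U(V⁺)`-factor in the determinant character).
[cite: KonnoKonno2007, Lemma 5.2 (i)/(ii) p. 73 L44–102] -/
theorem vacScalar_eP_of_isEmpty [IsEmpty P] (e : VacExponents) (a : ℤ) (k : DPK P Q R S) :
    vacScalar (⟨a, e.eQ, e.eR, e.eS⟩ : VacExponents) k = vacScalar e k := by
  simp only [vacScalar, Matrix.det_isEmpty, _root_.one_zpow]

/-- with `Q` empty the record `FockVacuumCharacter` does not see `e_Q`. [cite: KonnoKonno2007, Lemma 5.2 (i)/(ii) p. 73 L44–102] -/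
theorem _root_.Literature.RepresentationTheory.KonnoKonno2007.RealDualPairJunction.FockVacuumCharacter.eQ_irrel
    [IsEmpty Q] {Ginf : Type*} [Group Ginf] [TopologicalSpace Ginf] {D : RealDualPairJunction P Q R S Ginf}
    {e : VacExponents} (h : D.FockVacuumCharacter e) (b : ℤ) :
    D.FockVacuumCharacter ⟨e.eP, b, e.eR, e.eS⟩ := by
  obtain ⟨ω, hW, hvac⟩ := h
  exact ⟨ω, hW, fun k => by rw [vacScalar_eQ_of_isEmpty e b k]; exact hvac k⟩

/-- with `P` empty the record `FockVacuumCharacter` does not see `e_P`. [cite: KonnoKonno2007, Lemma 5.2 (i)/(ii) p. 73 L44–102] -/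
theorem _root_.Literature.RepresentationTheory.KonnoKonno2007.RealDualPairJunction.FockVacuumCharacter.eP_irrel
    [IsEmpty P] {Ginf : Type*} [Group Ginf] [TopologicalSpace Ginf] {D : RealDualPairJunction P Q R S Ginf}
    {e : VacExponents} (h : D.FockVacuumCharacter e) (a : ℤ) :
    D.FockVacuumCharacter ⟨a, e.eQ, e.eR, e.eS⟩ := by
  obtain ⟨ω, hW, hvac⟩ := h
  exact ⟨ω, hW, fun k => by rw [vacScalar_eP_of_isEmpty e a k]; exact hvac k⟩

/-- the maximal-compact inclusion `kV : U(α) × U(β) → U(α, β)`, `(a,b) ↦ diag(a,b)`, is injective.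
[cite: KonnoKonno2007, §3.1 (3.1) p. 44 L5–13] -/
theorem UForm.kV_injective {α β : Type*} [Fintype α] [DecidableEq α] [Fintype β] [DecidableEq β] :
    Function.Injective (UForm.kV α β) := by
  intro k k' h
  have h1 := congrArg (fun g : UForm α β => (((g : UForm α β) : GL (α ⊕ β) ℂ) : Matrix (α ⊕ β) (α ⊕ β) ℂ)) h
  simp only [UForm.coe_kV] at h1
  obtain ⟨h11, -, -, h22⟩ := Matrix.fromBlocks_inj.1 h1
  exact Prod.ext (Subtype.ext h11) (Subtype.ext h22)

/-- the maximal-compact inclusion `κ : K_V × K_W → G_∞` is injective. [cite: KonnoKonno2007, §3.1 (3.1) p. 44 L5–13] -/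
theorem κ_injective : Function.Injective (κ P Q R S) := fun k k' h => by
  have h1 := congrArg Prod.fst h
  have h2 := congrArg Prod.snd h
  exact Prod.ext (UForm.kV_injective h1) (UForm.kV_injective h2)

/-- **Both `V` and `W` definite: `κ : K_V × K_W → G_∞ = U(V) × U(W)` is a BIJECTION** (the maximal compact is everything).
[cite: Folland1989, Prop (4.39)] -/
theorem κ_bijective (hV : IsEmpty P ∨ IsEmpty Q) (hW : IsEmpty R ∨ IsEmpty S) : Function.Bijective (κ P Q R S) :=
  ⟨κ_injective, κ_surjective hV hW⟩

/-- `K_V × K_W = (U(P) × U(Q)) × (U(R) × U(S))` is compact (plumbing). [folklore] -/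
private theorem compactSpace_DPK : CompactSpace (DPK P Q R S) := by
  haveI := compactSpace_matrixUnitaryGroup P
  haveI := compactSpace_matrixUnitaryGroup Q
  haveI := compactSpace_matrixUnitaryGroup R
  haveI := compactSpace_matrixUnitaryGroup S
  infer_instance

/-- the determinant-power character `vacCharCircle e` of `K_V × K_W` is continuous (plumbing). [folklore] -/
private theorem continuous_vacCharCircle (e : VacExponents) : Continuous (vacCharCircle (P := P) (Q := Q) (R := R) (S := S) e) := by
  refine Continuous.subtype_mk ?_ _
  change Continuous fun k : DPK P Q R S => vacScalar e k
  simp only [vacScalar]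
  exact (((continuous_det_zpow_unitaryGroup P e.eP).comp (continuous_fst.comp continuous_fst)).mul
    ((continuous_det_zpow_unitaryGroup Q e.eQ).comp (continuous_snd.comp continuous_fst))).mul
    (((continuous_det_zpow_unitaryGroup R e.eR).comp (continuous_fst.comp continuous_snd)).mul
      ((continuous_det_zpow_unitaryGroup S e.eS).comp (continuous_snd.comp continuous_snd)))

/-- **Both definite: the compact pair's CONSTRUCTED Weil representation `dualPairWeilRep χ` transports along the bijection
`κ` to an archimedean Weil datum over the junction's `ι𝕎`, for EVERY continuous unitary character `χ` of `K_V × K_W`** — no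
metaplectic cocycle is needed when both members of the pair are compact (`κ` is then a homeomorphism of compact
Hausdorff groups and `ι𝕎 ∘ κ = realifySp ∘ dualPairι`). [cite: Folland1989, Prop (4.39); KonnoKonno2007, §3.1 (3.1) p. 44] -/
theorem exists_isArchWeilDatum_of_definite (hV : IsEmpty P ∨ IsEmpty Q) (hW : IsEmpty R ∨ IsEmpty S)
    (χ : DPK P Q R S →* Circle) (hχ : Continuous χ) :
    ∃ ω : Representation ℂ (Ginf P Q R S) (SchwartzMap (DPIdx P Q R S → ℝ) ℂ), IsArchWeilDatum (ι𝕎 P Q R S) ω ∧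
      ∀ (k : DPK P Q R S) (f : SchwartzMap (DPIdx P Q R S → ℝ) ℂ), ω (κ P Q R S k) f = dualPairWeilRep χ k f := by
  haveI : CompactSpace (DPK P Q R S) := compactSpace_DPK
  have hbij := κ_bijective (P := P) (Q := Q) (R := R) (S := S) hV hW
  let M : DPK P Q R S ≃* Ginf P Q R S := MulEquiv.ofBijective (κ P Q R S) hbij
  have hM : ∀ k, M k = κ P Q R S k := fun _ => rfl
  have hκM : ∀ g, κ P Q R S (M.symm g) = g := fun g => by rw [← hM, MulEquiv.apply_symm_apply]
  let H : DPK P Q R S ≃ₜ Ginf P Q R S :=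
    Continuous.homeoOfEquivCompactToT2 (f := Equiv.ofBijective (κ P Q R S) hbij) continuous_κ
  have hH : ∀ k, H k = κ P Q R S k := fun _ => rfl
  have hMH : (fun g => M.symm g) = fun g => H.symm g := by
    funext g
    apply hbij.1
    rw [hκM, ← hH, Homeomorph.apply_symm_apply]
  have hcont : Continuous fun g => M.symm g := by
    rw [hMH]
    exact H.symm.continuous
  have hD := isArchWeilDatum_dualPairWeilRep χ hχ
  refine ⟨(dualPairWeilRep χ).comp M.symm.toMonoidHom, ⟨fun f => ?_, fun g p q f => ?_, fun g => ?_⟩, fun k f => ?_⟩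
  · exact (hD.continuous_apply f).comp hcont
  · have h1 : ι𝕎 P Q R S g = realifySp (DPIdx P Q R S) (dualPairι (M.symm g)) := by
      conv_lhs => rw [← hκM g]
      exact ι𝕎_κ _
    have h2 := hD.covariant (M.symm g) p q f
    simp only [MonoidHom.coe_comp, Function.comp_apply] at h2
    dsimp only
    rw [MonoidHom.comp_apply, MulEquiv.coe_toMonoidHom, h1]
    exact h2
  · exact hD.exists_lift (M.symm g)
  · change dualPairWeilRep χ (M.symm (κ P Q R S k)) f = _
    rw [← hM, MulEquiv.symm_apply_apply]

/-- **Both `V` and `W` definite: EVERY exponent tuple is a vacuum exponent tuple of SOME archimedean Weil datum over the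
concrete junction** (`χ := vacCharCircle e` in `exists_isArchWeilDatum_of_definite`).  At a definite place NO vacuum exponent
is decided by the datum notion. [cite: KonnoKonno2007, Lemma 5.2 (i)/(ii) p. 73 L44–102; Folland1989, Prop (4.39)] -/
theorem fockVacuumCharacter_junction_of_definite (hV : IsEmpty P ∨ IsEmpty Q) (hW : IsEmpty R ∨ IsEmpty S)
    (e : VacExponents) : (junction P Q R S).FockVacuumCharacter e := by
  obtain ⟨ω, hω, h⟩ := exists_isArchWeilDatum_of_definite hV hW (vacCharCircle e) (continuous_vacCharCircle e)
  exact ⟨ω, hω, fun k => by rw [junction_κ, h, dualPairWeilRep_hermitePi_zero, coe_vacCharCircle]⟩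

/-- **Both definite: ONE archimedean Weil datum over the junction has the Gaussian INVARIANT under the whole group
`G_∞ = U(V) × U(W)`** (`χ := 1`; `κ` onto). [cite: Folland1989, §1.7, Prop (4.39)] -/
theorem exists_forall_vacuum_eq_self_of_definite (hV : IsEmpty P ∨ IsEmpty Q) (hW : IsEmpty R ∨ IsEmpty S) :
    ∃ ω : Representation ℂ (Ginf P Q R S) (SchwartzMap (DPIdx P Q R S → ℝ) ℂ), IsArchWeilDatum (ι𝕎 P Q R S) ω ∧
      ∀ g : Ginf P Q R S, ω g (hermitePi 0) = hermitePi 0 := by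
  obtain ⟨ω, hω, h⟩ := exists_isArchWeilDatum_of_definite hV hW 1 continuous_const
  refine ⟨ω, hω, fun g => ?_⟩
  obtain ⟨k, rfl⟩ := κ_surjective hV hW g
  rw [h, dualPairWeilRep_hermitePi_zero, MonoidHom.one_apply, Circle.coe_one, one_smul]

/-- **The `U(W)`-centre weights of the Hermite basis, for EVERY archimedean Weil datum over a junction**: there is ONE
exponent tuple `e` (the datum's vacuum exponents) with
`ω(κ((diag α, diag β), (t·1_R, t·1_S))) h_m = (vacScalar e · t^{deg_{PR} m + deg_{QS} m} · t̄^{deg_{PS} m + deg_{QR} m}) • h_m`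
on the diagonal torus — the tree's `IsArchWeilDatum.exists_torus_weights` composed with `dualPairι_diagHom` and
`torusChar_dpTorus_scalarW`, here read at `a = b = 1`. [cite: Folland1989, §1.7, Prop (4.39)] -/
theorem exists_forall_scalarW_hermitePi {ω : Representation ℂ (Ginf P Q R S) (SchwartzMap (DPIdx P Q R S → ℝ) ℂ)}
    (hω : IsArchWeilDatum (ι𝕎 P Q R S) ω) :
    ∃ e : VacExponents, (∀ k : DPK P Q R S, ω (κ P Q R S k) (hermitePi 0) = vacScalar e k • hermitePi 0) ∧
      ∀ (t : Circle) (m : DPIdx P Q R S →₀ ℕ),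
        ω (κ P Q R S (((1, 1), (diagHom (fun _ : R => t), diagHom (fun _ : S => t))) : DPK P Q R S)) (hermitePi m) =
          (vacScalar e (((1, 1), (diagHom (fun _ : R => t), diagHom (fun _ : S => t))) : DPK P Q R S) *
              (((t : Circle) : ℂ) ^ (degPR m + degQS m) * conj ((t : Circle) : ℂ) ^ (degPS m + degQR m))) •
            hermitePi m := by
  obtain ⟨χ, hχ, htorus, h0⟩ := hω.exists_torus_weights (κ P Q R S) continuous_κ dualPairι ι𝕎_κ
  obtain ⟨e, he⟩ := exists_vacExponents_of_continuous (P := P) (Q := Q) (R := R) (S := S) χ hχ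
  refine ⟨e, fun k => by rw [h0 k, he k], fun t m => ?_⟩
  have h1P : diagHom (fun _ : P => (1 : Circle)) = 1 := map_one diagHom
  have h1Q : diagHom (fun _ : Q => (1 : Circle)) = 1 := map_one diagHom
  have hdiag : dualPairι (((1 : Matrix.unitaryGroup P ℂ), (1 : Matrix.unitaryGroup Q ℂ)),
      (diagHom (fun _ : R => t), diagHom (fun _ : S => t))) =
      diagHom (dpTorus (fun _ : P => (1 : Circle)) (fun _ : Q => (1 : Circle)) (fun _ : R => t) (fun _ : S => t)) := by
    rw [← dualPairι_diagHom, h1P, h1Q]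
  rw [htorus _ _ hdiag m, he, torusChar_dpTorus_scalarW]

end Generic

/-! ## §1. The junction `U(3,0) × U(1,0)`: `(P,Q,R,S) = (Fin 3, ∅, Unit, ∅)` -/

section Def31Pos

/-- **THE DEFINITE JUNCTION `U(3,0) × U(1,0)` is inhabited with no hypothesis**: it is the tree's CONSTRUCTED
`junction (Fin 3) Empty Unit Empty`, with dual-pair map `ι𝕎 (Fin 3) Empty Unit Empty : U(3,0) × U(1,0) →* Sp(𝕎)`, compact
inclusion `κ` — here ONTO (both members are compact) — and `ι𝕎 ∘ κ = realifySp ∘ dualPairι` a theorem.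
[cite: KonnoKonno2007, §3.1 (3.1) p. 44 L5–13; Folland1989, Prop (4.39)] -/
theorem junction_def₃₁_spec :
    (junction (Fin 3) Empty Unit Empty).ι𝕎 = ι𝕎 (Fin 3) Empty Unit Empty ∧
      (junction (Fin 3) Empty Unit Empty).κ = κ (Fin 3) Empty Unit Empty ∧
      Function.Surjective (κ (Fin 3) Empty Unit Empty) ∧
      ∀ k : DPK (Fin 3) Empty Unit Empty,
        ι𝕎 (Fin 3) Empty Unit Empty (κ (Fin 3) Empty Unit Empty k) =
          realifySp (DPIdx (Fin 3) Empty Unit Empty) (dualPairι k) :=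
  ⟨rfl, rfl, κ_surjective (Or.inr inferInstance) (Or.inr inferInstance), ι𝕎_κ⟩

/-- **ONE archimedean Weil datum over `U(3,0) × U(1,0)` has the Gaussian INVARIANT under all of `U(3) × U(1)`** (the
compact pair's `dualPairWeilRep 1` transported along the bijection `κ`). [cite: Folland1989, §1.7, Prop (4.39);
KonnoKonno2007, Lemma 5.2 (i)/(ii) p. 73 L44–102] -/
theorem exists_forall_vacuum_eq_self_def₃₁ :
    ∃ ω : Representation ℂ (Ginf (Fin 3) Empty Unit Empty) (SchwartzMap (DPIdx (Fin 3) Empty Unit Empty → ℝ) ℂ),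
      IsArchWeilDatum (ι𝕎 (Fin 3) Empty Unit Empty) ω ∧
      ∀ g : Ginf (Fin 3) Empty Unit Empty, ω g (hermitePi 0) = hermitePi 0 :=
  exists_forall_vacuum_eq_self_of_definite (Or.inr inferInstance) (Or.inr inferInstance)

/-- **… and EVERY exponent tuple is realised at `U(3,0) × U(1,0)`** (both members definite: no exponent is decided by
the datum notion; the `U(W)`-weight `e_R` of the Gaussian is a normalisation of the datum).
[cite: KonnoKonno2007, Lemma 5.2 p. 73, Thm 5.4 (i) (5.6)–(5.7) p. 75] -/
theorem fockVacuumCharacter_def₃₁ (f : VacExponents) : (junction (Fin 3) Empty Unit Empty).FockVacuumCharacter f :=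
  fockVacuumCharacter_junction_of_definite (Or.inr inferInstance) (Or.inr inferInstance) f

/-- the total degree of a multi-index of the junction `U(3,0) × U(1,0)` is its `V⁺ ⊗ W⁺`-degree `deg_{PR}` (plumbing). [folklore] -/
private theorem degree_eq_degPR_def₃₁ (m : DPIdx (Fin 3) Empty Unit Empty →₀ ℕ) : m.degree = degPR m := by
  have h : m.degree = ∑ i, m i := by
    simp only [Finsupp.degree, AddMonoidHom.coe_mk, ZeroHom.coe_mk]
    exact Finset.sum_subset (Finset.subset_univ _) fun i _ hi => by simpa using hi
  rw [h, Fintype.sum_sum_type, Fintype.sum_sum_type, Fintype.sum_sum_type, degPR]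
  simp

/-- **THE `U(W) = U(1)`-WEIGHTS OF THE DEGREE LINES AT A DEFINITE PLACE, POSITIVE LINE.**  For EVERY archimedean Weil datum
`ω` over `U(3,0) × U(1,0)` there is ONE integer `e_R` (the datum's vacuum `U(W)`-exponent) such that the centre
`t ∈ U(1) = U(W)` acts on the Hermite vector `h_m` by **`t ^ (e_R + deg m)`**: the Gaussian carries `t^{e_R}`, the degree-`d`
lines carry `t^{e_R + d}` — the `U(W)`-characters occurring in the Fock model are exactly `t ↦ t^n`, `n ≥ e_R` (Folland's
«`U(1)` acts on `𝓟_k` by a character of degree `k`», with the sign of the tree's block datum: `+1` per `V⁺ ⊗ W⁺` variable).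
[cite: Folland1989, §1.7, Prop (4.39); KonnoKonno2007, Lemma 5.2 (i)/(ii) p. 73 L44–102, Thm 5.4 (i) (5.7) p. 75] -/
theorem exists_forall_scalarW_hermitePi_def₃₁
    {ω : Representation ℂ (Ginf (Fin 3) Empty Unit Empty) (SchwartzMap (DPIdx (Fin 3) Empty Unit Empty → ℝ) ℂ)}
    (hω : IsArchWeilDatum (ι𝕎 (Fin 3) Empty Unit Empty) ω) :
    ∃ eR : ℤ, ∀ (t : Circle) (m : DPIdx (Fin 3) Empty Unit Empty →₀ ℕ),
      ω (κ (Fin 3) Empty Unit Empty (((1, 1), (diagHom (fun _ : Unit => t), 1)) : DPK (Fin 3) Empty Unit Empty)) (hermitePi m) =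
        (((t : Circle) : ℂ) ^ (eR + (m.degree : ℤ))) • hermitePi m := by
  obtain ⟨e, -, h⟩ := exists_forall_scalarW_hermitePi hω
  refine ⟨e.eR, fun t m => ?_⟩
  have h1 : (diagHom (fun _ : Empty => t)) = 1 := Subtype.ext (by ext i; exact isEmptyElim i)
  have h2 := h t m
  rw [h1] at h2
  rw [h2, degree_eq_degPR_def₃₁]
  congr 1
  obtain ⟨hQS, hPS, hQR⟩ : degQS m = 0 ∧ degPS m = 0 ∧ degQR m = 0 := by simp [degQS, degPS, degQR]
  rw [hQS, hPS, hQR, add_zero, add_zero, pow_zero, mul_one]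
  have ht : ((t : Circle) : ℂ) ≠ 0 := Circle.coe_ne_zero t
  have hdet : ((diagHom (fun _ : Unit => t) : Matrix.unitaryGroup Unit ℂ) : Matrix Unit Unit ℂ).det = (t : ℂ) := by
    rw [coe_diagHom', Matrix.det_diagonal, Fintype.prod_unique]
  simp only [vacScalar, OneMemClass.coe_one, Matrix.det_one, _root_.one_zpow, one_mul, mul_one, hdet]
  rw [zpow_add₀ ht, zpow_natCast]

/-- **In particular the Gaussian at a definite place with a positive line carries the `U(W)`-character `t^{e_R}` and the
THREE degree-one vectors `h_{e_i}` carry `t^{e_R + 1}`** — the `U(W)`-ladder goes UP from the vacuum weight.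
[cite: Folland1989, Prop (4.39); KonnoKonno2007, Thm 5.4 (i) (5.7) p. 75] -/
theorem exists_scalarW_vacuum_and_degOne_def₃₁
    {ω : Representation ℂ (Ginf (Fin 3) Empty Unit Empty) (SchwartzMap (DPIdx (Fin 3) Empty Unit Empty → ℝ) ℂ)}
    (hω : IsArchWeilDatum (ι𝕎 (Fin 3) Empty Unit Empty) ω) :
    ∃ eR : ℤ, (∀ t : Circle,
        ω (κ (Fin 3) Empty Unit Empty (((1, 1), (diagHom (fun _ : Unit => t), 1)) : DPK (Fin 3) Empty Unit Empty)) (hermitePi 0) =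
          (((t : Circle) : ℂ) ^ eR) • hermitePi 0) ∧
      ∀ (t : Circle) (i : DPIdx (Fin 3) Empty Unit Empty),
        ω (κ (Fin 3) Empty Unit Empty (((1, 1), (diagHom (fun _ : Unit => t), 1)) : DPK (Fin 3) Empty Unit Empty)) (hermitePi (Finsupp.single i 1)) =
          (((t : Circle) : ℂ) ^ (eR + 1)) • hermitePi (Finsupp.single i 1) := by
  obtain ⟨eR, h⟩ := exists_forall_scalarW_hermitePi_def₃₁ hω
  refine ⟨eR, fun t => ?_, fun t i => ?_⟩
  · rw [h t 0, map_zero, Nat.cast_zero, add_zero]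
  · rw [h t (Finsupp.single i 1), Finsupp.degree_single, Nat.cast_one]

end Def31Pos

/-! ## §2. The junction `U(3,0) × U(0,1)`: `(P,Q,R,S) = (Fin 3, ∅, ∅, Unit)` (the line of the OTHER sign) -/

section Def31Neg

/-- **THE DEFINITE JUNCTION `U(3,0) × U(0,1)` is inhabited with no hypothesis**, `κ` onto, `ι𝕎 ∘ κ = realifySp ∘ dualPairι`.
[cite: KonnoKonno2007, §3.1 (3.1) p. 44 L5–13; Folland1989, Prop (4.39)] -/
theorem junction_def₃₁neg_spec :
    (junction (Fin 3) Empty Empty Unit).ι𝕎 = ι𝕎 (Fin 3) Empty Empty Unit ∧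
      (junction (Fin 3) Empty Empty Unit).κ = κ (Fin 3) Empty Empty Unit ∧
      Function.Surjective (κ (Fin 3) Empty Empty Unit) ∧
      ∀ k : DPK (Fin 3) Empty Empty Unit,
        ι𝕎 (Fin 3) Empty Empty Unit (κ (Fin 3) Empty Empty Unit k) =
          realifySp (DPIdx (Fin 3) Empty Empty Unit) (dualPairι k) :=
  ⟨rfl, rfl, κ_surjective (Or.inr inferInstance) (Or.inl inferInstance), ι𝕎_κ⟩

/-- **ONE archimedean Weil datum over `U(3,0) × U(0,1)` has the Gaussian INVARIANT under all of `U(3) × U(1)`.**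
[cite: Folland1989, §1.7, Prop (4.39); KonnoKonno2007, Lemma 5.2 (i)/(ii) p. 73 L44–102] -/
theorem exists_forall_vacuum_eq_self_def₃₁neg :
    ∃ ω : Representation ℂ (Ginf (Fin 3) Empty Empty Unit) (SchwartzMap (DPIdx (Fin 3) Empty Empty Unit → ℝ) ℂ),
      IsArchWeilDatum (ι𝕎 (Fin 3) Empty Empty Unit) ω ∧
      ∀ g : Ginf (Fin 3) Empty Empty Unit, ω g (hermitePi 0) = hermitePi 0 :=
  exists_forall_vacuum_eq_self_of_definite (Or.inr inferInstance) (Or.inl inferInstance)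

/-- **… and EVERY exponent tuple is realised at `U(3,0) × U(0,1)`.** [cite: KonnoKonno2007, Lemma 5.2 p. 73, Thm 5.4 (i) (5.6)–(5.7) p. 75] -/
theorem fockVacuumCharacter_def₃₁neg (f : VacExponents) : (junction (Fin 3) Empty Empty Unit).FockVacuumCharacter f :=
  fockVacuumCharacter_junction_of_definite (Or.inr inferInstance) (Or.inl inferInstance) f

/-- the total degree of a multi-index of the junction `U(3,0) × U(0,1)` is its `V⁺ ⊗ W⁻`-degree `deg_{PS}` (plumbing). [folklore] -/
private theorem degree_eq_degPS_def₃₁neg (m : DPIdx (Fin 3) Empty Empty Unit →₀ ℕ) : m.degree = degPS m := by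
  have h : m.degree = ∑ i, m i := by
    simp only [Finsupp.degree, AddMonoidHom.coe_mk, ZeroHom.coe_mk]
    exact Finset.sum_subset (Finset.subset_univ _) fun i _ hi => by simpa using hi
  rw [h, Fintype.sum_sum_type, Fintype.sum_sum_type, Fintype.sum_sum_type, degPS]
  simp

/-- **THE `U(W) = U(1)`-WEIGHTS OF THE DEGREE LINES AT A DEFINITE PLACE, NEGATIVE LINE.**  For EVERY archimedean Weil datum
`ω` over `U(3,0) × U(0,1)` there is ONE integer `e_S` with: the centre `t ∈ U(1) = U(W)` acts on `h_m` by **`t ^ (e_S − deg m)`**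
— the ladder goes DOWN from the vacuum weight (the variables are of the mixed type, on which the block datum puts the
conjugate weight): the occurring `U(W)`-characters are `t^n`, `n ≤ e_S`.
[cite: Folland1989, §1.7, Prop (4.39); KonnoKonno2007, Lemma 5.2 (i)/(ii) p. 73 L44–102, Thm 5.4 (i) (5.7) p. 75] -/
theorem exists_forall_scalarW_hermitePi_def₃₁neg
    {ω : Representation ℂ (Ginf (Fin 3) Empty Empty Unit) (SchwartzMap (DPIdx (Fin 3) Empty Empty Unit → ℝ) ℂ)}
    (hω : IsArchWeilDatum (ι𝕎 (Fin 3) Empty Empty Unit) ω) :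
    ∃ eS : ℤ, ∀ (t : Circle) (m : DPIdx (Fin 3) Empty Empty Unit →₀ ℕ),
      ω (κ (Fin 3) Empty Empty Unit (((1, 1), (1, diagHom (fun _ : Unit => t))) : DPK (Fin 3) Empty Empty Unit)) (hermitePi m) =
        (((t : Circle) : ℂ) ^ (eS - (m.degree : ℤ))) • hermitePi m := by
  obtain ⟨e, -, h⟩ := exists_forall_scalarW_hermitePi hω
  refine ⟨e.eS, fun t m => ?_⟩
  have h1 : (diagHom (fun _ : Empty => t)) = 1 := Subtype.ext (by ext i; exact isEmptyElim i)
  have h2 := h t m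
  rw [h1] at h2
  rw [h2, degree_eq_degPS_def₃₁neg]
  congr 1
  obtain ⟨hPR, hQS, hQR⟩ : degPR m = 0 ∧ degQS m = 0 ∧ degQR m = 0 := by simp [degPR, degQS, degQR]
  rw [hPR, hQS, hQR, add_zero, add_zero, pow_zero, one_mul]
  have ht : ((t : Circle) : ℂ) ≠ 0 := Circle.coe_ne_zero t
  have hdet : ((diagHom (fun _ : Unit => t) : Matrix.unitaryGroup Unit ℂ) : Matrix Unit Unit ℂ).det = (t : ℂ) := by
    rw [coe_diagHom', Matrix.det_diagonal, Fintype.prod_unique]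
  simp only [vacScalar, OneMemClass.coe_one, Matrix.det_one, _root_.one_zpow, one_mul, hdet]
  rw [← Circle.coe_inv_eq_conj, Circle.coe_inv, inv_pow, ← zpow_natCast, ← _root_.zpow_neg, ← zpow_add₀ ht,
    sub_eq_add_neg]

/-- **In particular at a definite place with a negative line the Gaussian carries `t^{e_S}` and the three degree-one vectors
carry `t^{e_S − 1}`.** [cite: Folland1989, Prop (4.39); KonnoKonno2007, Thm 5.4 (i) (5.7) p. 75] -/
theorem exists_scalarW_vacuum_and_degOne_def₃₁neg
    {ω : Representation ℂ (Ginf (Fin 3) Empty Empty Unit) (SchwartzMap (DPIdx (Fin 3) Empty Empty Unit → ℝ) ℂ)}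
    (hω : IsArchWeilDatum (ι𝕎 (Fin 3) Empty Empty Unit) ω) :
    ∃ eS : ℤ, (∀ t : Circle,
        ω (κ (Fin 3) Empty Empty Unit (((1, 1), (1, diagHom (fun _ : Unit => t))) : DPK (Fin 3) Empty Empty Unit)) (hermitePi 0) =
          (((t : Circle) : ℂ) ^ eS) • hermitePi 0) ∧
      ∀ (t : Circle) (i : DPIdx (Fin 3) Empty Empty Unit),
        ω (κ (Fin 3) Empty Empty Unit (((1, 1), (1, diagHom (fun _ : Unit => t))) : DPK (Fin 3) Empty Empty Unit)) (hermitePi (Finsupp.single i 1)) =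
          (((t : Circle) : ℂ) ^ (eS - 1)) • hermitePi (Finsupp.single i 1) := by
  obtain ⟨eS, h⟩ := exists_forall_scalarW_hermitePi_def₃₁neg hω
  refine ⟨eS, fun t => ?_, fun t i => ?_⟩
  · rw [h t 0, map_zero, Nat.cast_zero, sub_zero]
  · rw [h t (Finsupp.single i 1), Finsupp.degree_single, Nat.cast_one]

end Def31Neg

end RealDualPair

end Literature.RepresentationTheory.KonnoKonno2007

end
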